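import Literature.AlgebraicGeometry.Limits.FiniteLocallyFreeDescent
import Literature.AlgebraicGeometry.Limits.SubalgebraDiagram
import Literature.AlgebraicGeometry.KTheory.GrothendieckGroup
import HarnessLib

/-!
# `K₀` of a limit of schemes: every class comes from a stage

Topic: `Literature/AlgebraicGeometry/KTheory`. For the limit `c.pt = lim_i D i` of a cofiltered
diagram of quasi-compact quasi-separated schemes with affine transition maps (projections `π_i`),
the canonical map `colim_i K₀(D i) → K₀(c.pt)` is SURJECTIVE, for the Grothendieck group of
vector bundles `KTheory.KZero` and for its rationalisation `KTheory.KZeroRat`: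

* `KZero.exists_map_π_eq` — every `x ∈ K₀(c.pt)` is `π_i^* y` for some `i` and `y ∈ K₀(D i)`;
* `KZeroRat.exists_map_π_eq` — the same for `K₀(c.pt)_ℚ`;
* `KZeroRat.exists_map_prodCone_π_eq` — the instance for `P ×_K Spec B = lim_t P ×_K Spec K[t]`
  over the finitely generated subalgebras `K[t] ⊆ B` (`Limits/SubalgebraDiagram`): every class of
  `K₀(P ×_K Spec B)_ℚ` comes from `K₀(P ×_K Spec K[t])_ℚ` for some finite `t` (e.g. a class on the
  complex fibre `Y ⊗_R ℂ` of a scheme over a finitely generated ring `R` has a model over `R[t]`).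

This is the class-level shadow of The Stacks Project, Lemma 32.10.3 (1) (Tag 0B8W): every
finite locally free module on the limit is `π_i^*` of one on a stage
(`Limits/FiniteLocallyFreeDescent.exists_isFiniteLocallyFree_pullback_iso`) — so the generators
`[E]` of `K₀(c.pt)` descend, and finitely many stages are dominated by one (`IsCofiltered.min`,
functoriality `KZero.map_comp`). (The full statement `K(lim) ≃ colim K` for `K`-theory spectra is
Thomason–Trobaugh 1990, Prop. 3.20; only this elementary surjectivity on `K₀` of vector bundles is
recorded here.) Everything is proved; no named facts.

## References

* The Stacks Project, Lemma 32.10.3 (1) (Tag 0B8W). [StacksProject]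
* R. W. Thomason, T. Trobaugh, *Higher algebraic K-theory of schemes and of derived
  categories* (1990), Prop. 3.20. [ThomasonTrobaugh1990]
* W. Fulton, *Intersection theory* (1998), §15.1 (`K⁰`, pull-back). [Fulton1998]
-/

universe u

open CategoryTheory CategoryTheory.Limits AlgebraicGeometry TensorProduct
open Literature.AlgebraicGeometry.Motives

namespace Literature.AlgebraicGeometry.KTheory

set_option backward.isDefEq.respectTransparency false

variable {I : Type u} [Category.{u} I] [IsCofiltered I] (D : I ⥤ Scheme.{u})
  (c : Cone D) (hc : IsLimit c) [∀ {i j : I} (f : i ⟶ j), IsAffineHom (D.map f)]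
  [∀ i, CompactSpace (D.obj i)] [∀ i, QuasiSeparatedSpace (D.obj i)]

include hc in
/-- **Every class in `K₀(lim_i D i)` is pulled back from some stage**: for `x ∈ K₀(c.pt)` there
are `i` and `y ∈ K₀(D i)` with `π_i^* y = x` (generators: Stacks 0B8W (1); closure under sums:
two stages are dominated by `IsCofiltered.min`, and `π_k^* (D f)^* = π_i^*`).
[cite: StacksProject, Tag 0B8W (Lemma 32.10.3 (1))] -/
theorem KZero.exists_map_π_eq (x : KZero c.pt) :
    ∃ (i : I) (y : KZero (D.obj i)), KZero.map (c.π.app i) y = x := by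
  induction x using KZero.induction_on with
  | zero => exact ⟨(IsCofiltered.nonempty (C := I)).some, 0, map_zero _⟩
  | of E hE =>
    obtain ⟨i, ℰ, hℰ, ⟨e⟩⟩ := Limits.exists_isFiniteLocallyFree_pullback_iso D c hc hE
    exact ⟨i, KZero.of ℰ hℰ, by rw [KZero.map_of]; exact KZero.of_iso e _ _⟩
  | neg x hx =>
    obtain ⟨i, y, rfl⟩ := hx
    exact ⟨i, -y, map_neg _ _⟩
  | add x x' hx hx' =>
    obtain ⟨i, y, rfl⟩ := hx
    obtain ⟨i', y', rfl⟩ := hx'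
    refine ⟨IsCofiltered.min i i', KZero.map (D.map (IsCofiltered.minToLeft i i')) y +
      KZero.map (D.map (IsCofiltered.minToRight i i')) y', ?_⟩
    rw [map_add, ← KZero.map_comp_apply, ← KZero.map_comp_apply, c.w, c.w]
    rfl

include hc in
/-- **Every class in `K₀(lim_i D i)_ℚ` is pulled back from some stage.**
[cite: StacksProject, Tag 0B8W (Lemma 32.10.3 (1))] -/
theorem KZeroRat.exists_map_π_eq (x : KZeroRat c.pt) :
    ∃ (i : I) (y : KZeroRat (D.obj i)), KZeroRat.map (c.π.app i) y = x := by
  induction x using TensorProduct.induction_on with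
  | zero => exact ⟨(IsCofiltered.nonempty (C := I)).some, 0, map_zero _⟩
  | tmul a x =>
    obtain ⟨i, y, rfl⟩ := KZero.exists_map_π_eq D c hc x
    exact ⟨i, a ⊗ₜ[ℤ] y, KZeroRat.map_tmul _ _ _⟩
  | add x x' hx hx' =>
    obtain ⟨i, y, rfl⟩ := hx
    obtain ⟨i', y', rfl⟩ := hx'
    refine ⟨IsCofiltered.min i i', KZeroRat.map (D.map (IsCofiltered.minToLeft i i')) y +
      KZeroRat.map (D.map (IsCofiltered.minToRight i i')) y', ?_⟩
    rw [map_add, ← KZeroRat.map_comp_apply, ← KZeroRat.map_comp_apply, c.w, c.w]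
    rfl

omit [IsCofiltered I] [∀ {i j : I} (f : i ⟶ j), IsAffineHom (D.map f)]
  [∀ i, CompactSpace (D.obj i)] [∀ i, QuasiSeparatedSpace (D.obj i)] in
/-- **Classes of `K₀(P ×_K Spec B)_ℚ` come from a finitely generated subalgebra**: for `P` a
quasi-compact quasi-separated `K`-scheme, `B` a `K`-algebra and `s₁ ⊆ B` finite, every class of
`K₀((P ⊗ Spec B).left)_ℚ` is the pull-back of a class of `K₀((P ⊗ Spec K[t]).left)_ℚ` for some
finite `t ⊇ s₁` (the previous theorem for the system `SubalgApprox.prodCone`; EGA IV₃ 8.5.2 (ii),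
8.5.5 at the level of classes). [cite: StacksProject, Tag 0B8W (Lemma 32.10.3 (1))]
[cite: EGAIV3, Thm. 8.5.2 (ii), Cor. 8.5.5] -/
theorem KZeroRat.exists_map_prodCone_π_eq (K B : Type u) [CommRing K] [CommRing B] [Algebra K B]
    (s₁ : Finset B) (P : SchemeOver K) [QuasiCompact P.hom] [QuasiSeparated P.hom]
    (x : KZeroRat (Limits.SubalgApprox.prodCone K B s₁ P).pt) :
    ∃ (t : (Limits.SubalgApprox.Idx B s₁)ᵒᵖ)
      (y : KZeroRat ((Limits.SubalgApprox.prodDiagram K B s₁ P).obj t)),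
      KZeroRat.map ((Limits.SubalgApprox.prodCone K B s₁ P).π.app t) y = x :=
  KZeroRat.exists_map_π_eq _ _ (Limits.SubalgApprox.isLimitProdCone K B s₁ P) x

end Literature.AlgebraicGeometry.KTheory
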